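import Summits.BirchSwinnertonDyer.BirchSwinnertonDyer.Theorems.KatoDescentPotSupersingularWildUpperUnitTwistRecordsClassO616
import Summits.BirchSwinnertonDyer.BirchSwinnertonDyer.Theorems.KatoDescentPotSupersingularWildUpperUnitTwistRecordsFlat45
import Summits.BirchSwinnertonDyer.BirchSwinnertonDyer.Theorems.KatoDescentPotSupersingularWildUpperUnitTwistRecordsSharp21
import Summits.BirchSwinnertonDyer.BirchSwinnertonDyer.Theorems.KatoDescentPotSupersingularWildUpperUnitTwistRecordsSharp39
import Summits.BirchSwinnertonDyer.BirchSwinnertonDyer.Theorems.KatoDescentPotSupersingularWildUpperUnitTwistRecordsSharpP19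
import Summits.BirchSwinnertonDyer.BirchSwinnertonDyer.Theorems.KatoDescentPotSupersingularWildFineSelmerLayerOneL5Door
import HarnessLib

/-!
# Route `KatoDescentPotSupersingular` (rung K9, sub-rung B5 = O6 wild `p = 3`, cell `bsd-potss`): per-row records on the FACT-FREE door L5 at LAYER 1
# — statement (A) of Coates–Sujatha at `(E, 3)` with NO named fact, and U₀ modulo `hKatoA hGZK hmod`, for K9 U₀-ns rows with `E(ℚ₃)[3] ≠ 0` (door L6 and
# Deo–Ray–Sujatha's printed criterion void at every layer), part 10 of 12: 365040co1, 365040dq1, 365040ds1, 365040ga1, 365040ig1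
# (seat `bsd-potss-k9-c4` g25; road = this seat's door file `…WildFineSelmerLayerOneL5Door` over conjA-anchor g18's kernel door L5
# `CoatesSujatha2005.conjA_of_homTrivial_layer'` (p699505) + arithmetic (c3′) (p700300); `--supports stmt-BirchSwinnertonDyer-19197 --as helper`)

HONEST FRAMING. THEOREMS ONLY (no definition, no named fact, no `sorry`); PER ROW — NOT a class theorem; nothing is booked; items 19189 / 19197 /
19942 / 19386 stay OPEN at class level (class-wide open input of record: the zeta crux 24327); Conjecture A and BSD are proved for NO class of curves.
ROAD (door L5 of conjA-anchor g15 §2, KERNEL since g18 2026-08-29, layer `n + 1 = 1`, `L₁ = ℚ(E[3])·ℚ₁ = W.divisionField 3 ⊔ κ.layer 1`, `ℚ₁ = ℚ(ζ₉)⁺`):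
`E[3]` irreducible (kernel `irr_g…_3`) and `Δ(E)` a CUBE (kernel `Δ_cube_g…` here / `Δ_eq_cube_g…` imported ⟹ `3 ∤ #Gal(ℚ(E[3])/ℚ)`, (c1)); per bad prime
`q ≠ 3`: (c3′)₁ «`q` inert in `ℚ₁`» for `q ≢ ±1 (mod 9)` — KERNEL (`decide`, door lemma `not_decomp_le_layerSubgroup_one`) —, else (c3) «`E(ℚ_q)[3] = 0`»
DISPLAYED in the `E[3]`-currency (`hc3_q`: no non-zero point of `E[3]` is fixed by the decomposition group at `q`; numerically `#E(ℚ_q)[3] = 1`, the `q:1`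
entry of the kit I-line `badloc`); and ONE displayed class-group datum of `L₁` quantified over every cyclotomic `κ` (they share `ℚ₁`), in the shape the row
needs: (S) `hS` «every additive `Cl(𝓞_{L₁}) → E[3]` killing the classes above `3` and the bad primes is `0`» (= the `3`-part of `Cl(L₁)/⟨S-classes⟩` is
trivial: kit `r3S = 0`), (C) `hh1` «`3 ∤ h(L₁)`» (no bad-prime data), or (E) `hL5` = (c2)_{S,1} verbatim («every `Γ_ℚ`-EQUIVARIANT additive … is `0`»:
kit `r3S > 0` but `E[3]` absent from the `S`-split class group, covariant convention of `drsl1.gp`, convention certificate kit j313432) ⟹ (A) at `(E,3)`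
for every cyclotomic `ℤ₃`-extension — NO NAMED FACT (`conjA_g…_3_L5`); and U₀ `MissingUpperBoundAt E 3` modulo `hKatoA hGZK hmod` + Cremona's
`r_an = 0` (`missingUpperBoundAt_g…_3_L5`).  NOTHING is assumed at `3`: these rows have `#E(ℚ₃)[3] = 3` (kit j265757 / j313803 / j314664 / j314667
I-lines), so door L6 (`…ClassNumberL6Records`) and the Deo–Ray–Sujatha records cannot serve them; their earlier U₀/(A) records all display a
`μ`-input, Ferrero–Washington, a Fukuda fact or an anchor.  NUMERICS (conjA-anchor g15, PARI/GP 2.17, engines `drsl1.gp` 83fb2bf749aa288c /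
`l5layer1p.gp`; class groups of the degree-24 (`3Ns`) / degree-48 (`3Nn`) field `L₁` under GRH — `bnfcertify` of a degree-24 `L₁` did not finish in
1 h 50, kit j313888): per row `h(L₁)`, its cyclic structure, the `3`-rank `r3S` of `Cl(L₁)/⟨classes of the primes above 3 and the bad primes⟩` and the
number of such primes are quoted in the section header.  KERNEL lemmas `isElliptic_g…`, `isGloballyMinimal_g…`, `irr_g…_3`, `classO6_g…_3`
(and `Δ_eq_cube_g…` for the residue rows) are IMPORTED (k9-c4 g16–g18 / k8t-c4 g15 files, namespace `…Theorems.WildUpperUnitTwistRecords`).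

References: [CoatesSujatha2005] Thm. 3.4, Lemma 3.8; [DeoRaySujatha2023] Thm. 3.8 (c1)(c2)(c3) (arXiv:2202.09937 p. 9); [LimSujatha2018] §3;
[Washington1997] §13.1; [Marcus2018] Ch. 4 Ex. 12(a); [Serre1972] §2.4 Prop. 15, §5.3; [Kato2004Asterisque] Thm. 14.5 (3), Prop. 14.16 (2); [Cremona2006] Table 1.
-/

set_option autoImplicit false
set_option linter.dupNamespace false

noncomputable section

open scoped Classical NumberField nonZeroDivisors
open WeierstrassCurve NumberField Field IsDedekindDomain IntermediateField
  Literature.NumberTheory.EllipticCurves Literature.NumberTheory.EllipticCurves.Rank1Residual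
  Literature.NumberTheory.EllipticCurves.Rank1Residual.Typed
  Literature.NumberTheory.GaloisRepresentations Literature.NumberTheory.NumberFields
  Literature.NumberTheory.SerreUniformity Literature.NumberTheory.IwasawaTheory
  Summit.BirchSwinnertonDyer.Rank1Residual Summit.BirchSwinnertonDyer.Rank1Residual.Additive
  Summit.BirchSwinnertonDyer.BirchSwinnertonDyer.Theorems
  Summit.BirchSwinnertonDyer.BirchSwinnertonDyer.Theorems.WildUpperUnitTwistRecords

namespace Summit.BirchSwinnertonDyer.BirchSwinnertonDyer.Theorems.WildFineSelmerLayerOneL5Records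

/-! ### `365040co1` @ `p = 3` — `N = 365040`; Cremona: `r_an = 0`; O6 wild at `3`; image `3Ns`; `ℚ(E[3])` of degree 8 (`h = 8`); `#E(ℚ₃)[3] = 3`;
bad places `2:1;5:3;13:1` (`q:#E(ℚ_q)[3]`); LAYER 1 (kit j314664, GRH): `L₁` of degree 24, `h(L₁) = 8` `[4, 2]`, 12 primes of `L₁` above `3` and the bad primes,
`3`-rank of `Cl(L₁)/⟨their classes⟩` = 0. Shape (C). First (A)/U₀ record for this row free of `μ`-inputs, Fukuda facts and anchors. -/

/-- `Δ(365040co1) = ((-4745520))³` — a CUBE (kernel, `norm_num`). [cite: Serre1972, §5.3] [cite: Cremona2006, Table 1 (Cremona label 365040co1)] -/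
theorem Δ_cube_g365040co1 : (⟨0, 0, 0, (-1898208), (-1122790032)⟩ : WeierstrassCurve ℚ).Δ = (((-4745520) : ℚ)) ^ 3 := by
  norm_num [WeierstrassCurve.Δ, WeierstrassCurve.b₂, WeierstrassCurve.b₄, WeierstrassCurve.b₆, WeierstrassCurve.b₈]

/-- **(A) AT `(365040co1, 3)` — NO NAMED FACT.**  Statement (A) of Coates–Sujatha for THIS curve at `p = 3` (the dual fine Selmer group over `ℚ_cyc` is
finitely generated over `ℤ₃`, every cyclotomic `ℤ₃`-extension), by door L5 at layer 1, shape (C): KERNEL `irr_g365040co1_3`, `Δ_cube_g365040co1`;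
DISPLAYED `hh1` (`3 ∤ h(L₁) = 8`, GRH, kit j314664). Per row; nothing booked; (A)/BSD proved for no class.
[cite: CoatesSujatha2005, §3 Thm. 3.4 and Lemma 3.8] [cite: DeoRaySujatha2023, §3 Thm. 3.8 (c1), (c2), (c3) (arXiv:2202.09937 p. 9)]
[cite: Serre1972, §2.4 Prop. 15, §5.3] [cite: Cremona2006, Table 1 (Cremona label 365040co1)] -/
theorem conjA_g365040co1_3_L5
    {W : WeierstrassCurve ℚ} [W.IsElliptic] (hWeq : W = (⟨0, 0, 0, (-1898208), (-1122790032)⟩ : WeierstrassCurve ℚ))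
    (hh1 : ∀ κ : ZpExtension ℚ 3, κ.IsCyclotomic →
      haveI := κ.isGalois_layer_holds (0 + 1)
      haveI := κ.finiteDimensional_layer_holds (0 + 1)
      haveI : NumberField ↥(W.divisionField 3 ⊔ κ.layer (0 + 1)) := NumberField.of_module_finite ℚ _
      ¬ 3 ∣ NumberField.classNumber ↥(W.divisionField 3 ⊔ κ.layer (0 + 1)))
    (κ : ZpExtension ℚ 3) (hκ : κ.IsCyclotomic) :
    ∃ (γ : absoluteGaloisGroup ℚ) (Df : W.FineSelmerDualData κ γ),
      Module.Finite ℤ_[3] (RestrictScalars ℤ_[3] (IwasawaAlgebra 3) Df.X) := by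
  subst hWeq
  exact WildFineSelmerLayerOneL5Door.conjA_three_layer_one_of_Δ_eq_cube_of_not_dvd_classNumber _ irr_g365040co1_3 Δ_cube_g365040co1 hh1 κ hκ

/-- **RECORD — U₀ `ord₃ #Ш(E) ≤ ord₃ #Ш(E)_an` for `E = 365040co1` at `p = 3` on the fact-free door L5 (layer 1, shape (C))** (U₀-ns row of K9 items
19189 / 19197): KERNEL `classO6_g365040co1_3`, `irr_g365040co1_3`, `Δ_cube_g365040co1`; DISPLAYED named facts `hKatoA hGZK hmod` ONLY, Cremona's `r_an = 0` (`hr`), and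
`hh1` (`3 ∤ h(L₁) = 8`, GRH, kit j314664). Per row; nothing booked; BSD is not proved by this.
[cite: Kato2004Asterisque, Thm. 14.5 (3) (p. 236) and Prop. 14.16 (2)] [cite: CoatesSujatha2005, §3 Thm. 3.4]
[cite: DeoRaySujatha2023, §3 Thm. 3.8] [cite: Cremona2006, Table 1 (Cremona label 365040co1)] -/
theorem missingUpperBoundAt_g365040co1_3_L5
    (hKatoA : Kato2004.rankZero_padicValNat_sha_add_padicValNat_tamagawa_le_of_additive_potGood_of_irreducible_of_fineSelmerDual_fg)
    (hGZK : rank_eq_analyticRank_of_analyticRank_le_one) (hmod : hasEntireLFunction_rat)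
    {W : WeierstrassCurve ℚ} [W.IsElliptic] [W.IsGloballyMinimal] (hWeq : W = (⟨0, 0, 0, (-1898208), (-1122790032)⟩ : WeierstrassCurve ℚ)) (hr : W.analyticRank = 0)
    (hh1 : ∀ κ : ZpExtension ℚ 3, κ.IsCyclotomic →
      haveI := κ.isGalois_layer_holds (0 + 1)
      haveI := κ.finiteDimensional_layer_holds (0 + 1)
      haveI : NumberField ↥(W.divisionField 3 ⊔ κ.layer (0 + 1)) := NumberField.of_module_finite ℚ _
      ¬ 3 ∣ NumberField.classNumber ↥(W.divisionField 3 ⊔ κ.layer (0 + 1))) :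
    MissingUpperBoundAt W 3 := by
  subst hWeq
  haveI : Fact (Nat.Prime 3) := ⟨Nat.prime_three⟩
  exact WildFineSelmerSupersingularCMAnchor.missingUpperBoundAt_wild_of_conjA hKatoA hGZK hmod _ hr classO6_g365040co1_3 irr_g365040co1_3
    (fun κ hκ => conjA_g365040co1_3_L5 rfl hh1 κ hκ)

/-! ### `365040dq1` @ `p = 3` — `N = 365040`; Cremona: `r_an = 0`; O6 wild at `3`; image `3Ns`; `ℚ(E[3])` of degree 8 (`h = 8`); `#E(ℚ₃)[3] = 3`;
bad places `2:1;5:3;13:1` (`q:#E(ℚ_q)[3]`); LAYER 1 (kit j314664, GRH): `L₁` of degree 24, `h(L₁) = 8` `[4, 2]`, 12 primes of `L₁` above `3` and the bad primes,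
`3`-rank of `Cl(L₁)/⟨their classes⟩` = 0. Shape (C). First (A)/U₀ record for this row free of `μ`-inputs, Fukuda facts and anchors. -/

/-- `Δ(365040dq1) = (31200)³` — a CUBE (kernel, `norm_num`). [cite: Serre1972, §5.3] [cite: Cremona2006, Table 1 (Cremona label 365040dq1)] -/
theorem Δ_cube_g365040dq1 : (⟨0, 0, 0, (-93483), (-10998182)⟩ : WeierstrassCurve ℚ).Δ = ((31200 : ℚ)) ^ 3 := by
  norm_num [WeierstrassCurve.Δ, WeierstrassCurve.b₂, WeierstrassCurve.b₄, WeierstrassCurve.b₆, WeierstrassCurve.b₈]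

/-- **(A) AT `(365040dq1, 3)` — NO NAMED FACT.**  Statement (A) of Coates–Sujatha for THIS curve at `p = 3` (the dual fine Selmer group over `ℚ_cyc` is
finitely generated over `ℤ₃`, every cyclotomic `ℤ₃`-extension), by door L5 at layer 1, shape (C): KERNEL `irr_g365040dq1_3`, `Δ_cube_g365040dq1`;
DISPLAYED `hh1` (`3 ∤ h(L₁) = 8`, GRH, kit j314664). Per row; nothing booked; (A)/BSD proved for no class.
[cite: CoatesSujatha2005, §3 Thm. 3.4 and Lemma 3.8] [cite: DeoRaySujatha2023, §3 Thm. 3.8 (c1), (c2), (c3) (arXiv:2202.09937 p. 9)]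
[cite: Serre1972, §2.4 Prop. 15, §5.3] [cite: Cremona2006, Table 1 (Cremona label 365040dq1)] -/
theorem conjA_g365040dq1_3_L5
    {W : WeierstrassCurve ℚ} [W.IsElliptic] (hWeq : W = (⟨0, 0, 0, (-93483), (-10998182)⟩ : WeierstrassCurve ℚ))
    (hh1 : ∀ κ : ZpExtension ℚ 3, κ.IsCyclotomic →
      haveI := κ.isGalois_layer_holds (0 + 1)
      haveI := κ.finiteDimensional_layer_holds (0 + 1)
      haveI : NumberField ↥(W.divisionField 3 ⊔ κ.layer (0 + 1)) := NumberField.of_module_finite ℚ _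
      ¬ 3 ∣ NumberField.classNumber ↥(W.divisionField 3 ⊔ κ.layer (0 + 1)))
    (κ : ZpExtension ℚ 3) (hκ : κ.IsCyclotomic) :
    ∃ (γ : absoluteGaloisGroup ℚ) (Df : W.FineSelmerDualData κ γ),
      Module.Finite ℤ_[3] (RestrictScalars ℤ_[3] (IwasawaAlgebra 3) Df.X) := by
  subst hWeq
  exact WildFineSelmerLayerOneL5Door.conjA_three_layer_one_of_Δ_eq_cube_of_not_dvd_classNumber _ irr_g365040dq1_3 Δ_cube_g365040dq1 hh1 κ hκ

/-- **RECORD — U₀ `ord₃ #Ш(E) ≤ ord₃ #Ш(E)_an` for `E = 365040dq1` at `p = 3` on the fact-free door L5 (layer 1, shape (C))** (U₀-ns row of K9 items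
19189 / 19197): KERNEL `classO6_g365040dq1_3`, `irr_g365040dq1_3`, `Δ_cube_g365040dq1`; DISPLAYED named facts `hKatoA hGZK hmod` ONLY, Cremona's `r_an = 0` (`hr`), and
`hh1` (`3 ∤ h(L₁) = 8`, GRH, kit j314664). Per row; nothing booked; BSD is not proved by this.
[cite: Kato2004Asterisque, Thm. 14.5 (3) (p. 236) and Prop. 14.16 (2)] [cite: CoatesSujatha2005, §3 Thm. 3.4]
[cite: DeoRaySujatha2023, §3 Thm. 3.8] [cite: Cremona2006, Table 1 (Cremona label 365040dq1)] -/
theorem missingUpperBoundAt_g365040dq1_3_L5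
    (hKatoA : Kato2004.rankZero_padicValNat_sha_add_padicValNat_tamagawa_le_of_additive_potGood_of_irreducible_of_fineSelmerDual_fg)
    (hGZK : rank_eq_analyticRank_of_analyticRank_le_one) (hmod : hasEntireLFunction_rat)
    {W : WeierstrassCurve ℚ} [W.IsElliptic] [W.IsGloballyMinimal] (hWeq : W = (⟨0, 0, 0, (-93483), (-10998182)⟩ : WeierstrassCurve ℚ)) (hr : W.analyticRank = 0)
    (hh1 : ∀ κ : ZpExtension ℚ 3, κ.IsCyclotomic →
      haveI := κ.isGalois_layer_holds (0 + 1)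
      haveI := κ.finiteDimensional_layer_holds (0 + 1)
      haveI : NumberField ↥(W.divisionField 3 ⊔ κ.layer (0 + 1)) := NumberField.of_module_finite ℚ _
      ¬ 3 ∣ NumberField.classNumber ↥(W.divisionField 3 ⊔ κ.layer (0 + 1))) :
    MissingUpperBoundAt W 3 := by
  subst hWeq
  haveI : Fact (Nat.Prime 3) := ⟨Nat.prime_three⟩
  exact WildFineSelmerSupersingularCMAnchor.missingUpperBoundAt_wild_of_conjA hKatoA hGZK hmod _ hr classO6_g365040dq1_3 irr_g365040dq1_3
    (fun κ hκ => conjA_g365040dq1_3_L5 rfl hh1 κ hκ)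

/-! ### `365040ds1` @ `p = 3` — `N = 365040`; Cremona: `r_an = 0`; O6 wild at `3`; image `3Ns`; `ℚ(E[3])` of degree 8 (`h = 8`); `#E(ℚ₃)[3] = 3`;
bad places `2:1;5:3;13:1` (`q:#E(ℚ_q)[3]`); LAYER 1 (kit j314664, GRH): `L₁` of degree 24, `h(L₁) = 8` `[4, 2]`, 12 primes of `L₁` above `3` and the bad primes,
`3`-rank of `Cl(L₁)/⟨their classes⟩` = 0. Shape (C). First (A)/U₀ record for this row free of `μ`-inputs, Fukuda facts and anchors. -/

/-- `Δ(365040ds1) = ((-75928320))³` — a CUBE (kernel, `norm_num`). [cite: Serre1972, §5.3] [cite: Cremona2006, Table 1 (Cremona label 365040ds1)] -/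
theorem Δ_cube_g365040ds1 : (⟨0, 0, 0, (-388954683), (-2952717236118)⟩ : WeierstrassCurve ℚ).Δ = (((-75928320) : ℚ)) ^ 3 := by
  norm_num [WeierstrassCurve.Δ, WeierstrassCurve.b₂, WeierstrassCurve.b₄, WeierstrassCurve.b₆, WeierstrassCurve.b₈]

/-- **(A) AT `(365040ds1, 3)` — NO NAMED FACT.**  Statement (A) of Coates–Sujatha for THIS curve at `p = 3` (the dual fine Selmer group over `ℚ_cyc` is
finitely generated over `ℤ₃`, every cyclotomic `ℤ₃`-extension), by door L5 at layer 1, shape (C): KERNEL `irr_g365040ds1_3`, `Δ_cube_g365040ds1`;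
DISPLAYED `hh1` (`3 ∤ h(L₁) = 8`, GRH, kit j314664). Per row; nothing booked; (A)/BSD proved for no class.
[cite: CoatesSujatha2005, §3 Thm. 3.4 and Lemma 3.8] [cite: DeoRaySujatha2023, §3 Thm. 3.8 (c1), (c2), (c3) (arXiv:2202.09937 p. 9)]
[cite: Serre1972, §2.4 Prop. 15, §5.3] [cite: Cremona2006, Table 1 (Cremona label 365040ds1)] -/
theorem conjA_g365040ds1_3_L5
    {W : WeierstrassCurve ℚ} [W.IsElliptic] (hWeq : W = (⟨0, 0, 0, (-388954683), (-2952717236118)⟩ : WeierstrassCurve ℚ))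
    (hh1 : ∀ κ : ZpExtension ℚ 3, κ.IsCyclotomic →
      haveI := κ.isGalois_layer_holds (0 + 1)
      haveI := κ.finiteDimensional_layer_holds (0 + 1)
      haveI : NumberField ↥(W.divisionField 3 ⊔ κ.layer (0 + 1)) := NumberField.of_module_finite ℚ _
      ¬ 3 ∣ NumberField.classNumber ↥(W.divisionField 3 ⊔ κ.layer (0 + 1)))
    (κ : ZpExtension ℚ 3) (hκ : κ.IsCyclotomic) :
    ∃ (γ : absoluteGaloisGroup ℚ) (Df : W.FineSelmerDualData κ γ),
      Module.Finite ℤ_[3] (RestrictScalars ℤ_[3] (IwasawaAlgebra 3) Df.X) := by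
  subst hWeq
  exact WildFineSelmerLayerOneL5Door.conjA_three_layer_one_of_Δ_eq_cube_of_not_dvd_classNumber _ irr_g365040ds1_3 Δ_cube_g365040ds1 hh1 κ hκ

/-- **RECORD — U₀ `ord₃ #Ш(E) ≤ ord₃ #Ш(E)_an` for `E = 365040ds1` at `p = 3` on the fact-free door L5 (layer 1, shape (C))** (U₀-ns row of K9 items
19189 / 19197): KERNEL `classO6_g365040ds1_3`, `irr_g365040ds1_3`, `Δ_cube_g365040ds1`; DISPLAYED named facts `hKatoA hGZK hmod` ONLY, Cremona's `r_an = 0` (`hr`), and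
`hh1` (`3 ∤ h(L₁) = 8`, GRH, kit j314664). Per row; nothing booked; BSD is not proved by this.
[cite: Kato2004Asterisque, Thm. 14.5 (3) (p. 236) and Prop. 14.16 (2)] [cite: CoatesSujatha2005, §3 Thm. 3.4]
[cite: DeoRaySujatha2023, §3 Thm. 3.8] [cite: Cremona2006, Table 1 (Cremona label 365040ds1)] -/
theorem missingUpperBoundAt_g365040ds1_3_L5
    (hKatoA : Kato2004.rankZero_padicValNat_sha_add_padicValNat_tamagawa_le_of_additive_potGood_of_irreducible_of_fineSelmerDual_fg)
    (hGZK : rank_eq_analyticRank_of_analyticRank_le_one) (hmod : hasEntireLFunction_rat)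
    {W : WeierstrassCurve ℚ} [W.IsElliptic] [W.IsGloballyMinimal] (hWeq : W = (⟨0, 0, 0, (-388954683), (-2952717236118)⟩ : WeierstrassCurve ℚ)) (hr : W.analyticRank = 0)
    (hh1 : ∀ κ : ZpExtension ℚ 3, κ.IsCyclotomic →
      haveI := κ.isGalois_layer_holds (0 + 1)
      haveI := κ.finiteDimensional_layer_holds (0 + 1)
      haveI : NumberField ↥(W.divisionField 3 ⊔ κ.layer (0 + 1)) := NumberField.of_module_finite ℚ _
      ¬ 3 ∣ NumberField.classNumber ↥(W.divisionField 3 ⊔ κ.layer (0 + 1))) :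
    MissingUpperBoundAt W 3 := by
  subst hWeq
  haveI : Fact (Nat.Prime 3) := ⟨Nat.prime_three⟩
  exact WildFineSelmerSupersingularCMAnchor.missingUpperBoundAt_wild_of_conjA hKatoA hGZK hmod _ hr classO6_g365040ds1_3 irr_g365040ds1_3
    (fun κ hκ => conjA_g365040ds1_3_L5 rfl hh1 κ hκ)

/-! ### `365040ga1` @ `p = 3` — `N = 365040`; Cremona: `r_an = 0`; O6 wild at `3`; image `3Ns`; `ℚ(E[3])` of degree 8 (`h = 8`); `#E(ℚ₃)[3] = 3`;
bad places `2:1;5:3;13:1` (`q:#E(ℚ_q)[3]`); LAYER 1 (kit j314664, GRH): `L₁` of degree 24, `h(L₁) = 8` `[4, 2]`, 12 primes of `L₁` above `3` and the bad primes,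
`3`-rank of `Cl(L₁)/⟨their classes⟩` = 0. Shape (C). First (A)/U₀ record for this row free of `μ`-inputs, Fukuda facts and anchors. -/

/-- `Δ(365040ga1) = ((-527280))³` — a CUBE (kernel, `norm_num`). [cite: Serre1972, §5.3] [cite: Cremona2006, Table 1 (Cremona label 365040ga1)] -/
theorem Δ_cube_g365040ga1 : (⟨0, 0, 0, (-210912), 41584816⟩ : WeierstrassCurve ℚ).Δ = (((-527280) : ℚ)) ^ 3 := by
  norm_num [WeierstrassCurve.Δ, WeierstrassCurve.b₂, WeierstrassCurve.b₄, WeierstrassCurve.b₆, WeierstrassCurve.b₈]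

/-- **(A) AT `(365040ga1, 3)` — NO NAMED FACT.**  Statement (A) of Coates–Sujatha for THIS curve at `p = 3` (the dual fine Selmer group over `ℚ_cyc` is
finitely generated over `ℤ₃`, every cyclotomic `ℤ₃`-extension), by door L5 at layer 1, shape (C): KERNEL `irr_g365040ga1_3`, `Δ_cube_g365040ga1`;
DISPLAYED `hh1` (`3 ∤ h(L₁) = 8`, GRH, kit j314664). Per row; nothing booked; (A)/BSD proved for no class.
[cite: CoatesSujatha2005, §3 Thm. 3.4 and Lemma 3.8] [cite: DeoRaySujatha2023, §3 Thm. 3.8 (c1), (c2), (c3) (arXiv:2202.09937 p. 9)]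
[cite: Serre1972, §2.4 Prop. 15, §5.3] [cite: Cremona2006, Table 1 (Cremona label 365040ga1)] -/
theorem conjA_g365040ga1_3_L5
    {W : WeierstrassCurve ℚ} [W.IsElliptic] (hWeq : W = (⟨0, 0, 0, (-210912), 41584816⟩ : WeierstrassCurve ℚ))
    (hh1 : ∀ κ : ZpExtension ℚ 3, κ.IsCyclotomic →
      haveI := κ.isGalois_layer_holds (0 + 1)
      haveI := κ.finiteDimensional_layer_holds (0 + 1)
      haveI : NumberField ↥(W.divisionField 3 ⊔ κ.layer (0 + 1)) := NumberField.of_module_finite ℚ _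
      ¬ 3 ∣ NumberField.classNumber ↥(W.divisionField 3 ⊔ κ.layer (0 + 1)))
    (κ : ZpExtension ℚ 3) (hκ : κ.IsCyclotomic) :
    ∃ (γ : absoluteGaloisGroup ℚ) (Df : W.FineSelmerDualData κ γ),
      Module.Finite ℤ_[3] (RestrictScalars ℤ_[3] (IwasawaAlgebra 3) Df.X) := by
  subst hWeq
  exact WildFineSelmerLayerOneL5Door.conjA_three_layer_one_of_Δ_eq_cube_of_not_dvd_classNumber _ irr_g365040ga1_3 Δ_cube_g365040ga1 hh1 κ hκ

/-- **RECORD — U₀ `ord₃ #Ш(E) ≤ ord₃ #Ш(E)_an` for `E = 365040ga1` at `p = 3` on the fact-free door L5 (layer 1, shape (C))** (U₀-ns row of K9 items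
19189 / 19197): KERNEL `classO6_g365040ga1_3`, `irr_g365040ga1_3`, `Δ_cube_g365040ga1`; DISPLAYED named facts `hKatoA hGZK hmod` ONLY, Cremona's `r_an = 0` (`hr`), and
`hh1` (`3 ∤ h(L₁) = 8`, GRH, kit j314664). Per row; nothing booked; BSD is not proved by this.
[cite: Kato2004Asterisque, Thm. 14.5 (3) (p. 236) and Prop. 14.16 (2)] [cite: CoatesSujatha2005, §3 Thm. 3.4]
[cite: DeoRaySujatha2023, §3 Thm. 3.8] [cite: Cremona2006, Table 1 (Cremona label 365040ga1)] -/
theorem missingUpperBoundAt_g365040ga1_3_L5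
    (hKatoA : Kato2004.rankZero_padicValNat_sha_add_padicValNat_tamagawa_le_of_additive_potGood_of_irreducible_of_fineSelmerDual_fg)
    (hGZK : rank_eq_analyticRank_of_analyticRank_le_one) (hmod : hasEntireLFunction_rat)
    {W : WeierstrassCurve ℚ} [W.IsElliptic] [W.IsGloballyMinimal] (hWeq : W = (⟨0, 0, 0, (-210912), 41584816⟩ : WeierstrassCurve ℚ)) (hr : W.analyticRank = 0)
    (hh1 : ∀ κ : ZpExtension ℚ 3, κ.IsCyclotomic →
      haveI := κ.isGalois_layer_holds (0 + 1)
      haveI := κ.finiteDimensional_layer_holds (0 + 1)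
      haveI : NumberField ↥(W.divisionField 3 ⊔ κ.layer (0 + 1)) := NumberField.of_module_finite ℚ _
      ¬ 3 ∣ NumberField.classNumber ↥(W.divisionField 3 ⊔ κ.layer (0 + 1))) :
    MissingUpperBoundAt W 3 := by
  subst hWeq
  haveI : Fact (Nat.Prime 3) := ⟨Nat.prime_three⟩
  exact WildFineSelmerSupersingularCMAnchor.missingUpperBoundAt_wild_of_conjA hKatoA hGZK hmod _ hr classO6_g365040ga1_3 irr_g365040ga1_3
    (fun κ hκ => conjA_g365040ga1_3_L5 rfl hh1 κ hκ)

/-! ### `365040ig1` @ `p = 3` — `N = 365040`; Cremona: `r_an = 0`; O6 wild at `3`; image `3Ns`; `ℚ(E[3])` of degree 8 (`h = 8`); `#E(ℚ₃)[3] = 3`;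
bad places `2:1;5:3;13:1` (`q:#E(ℚ_q)[3]`); LAYER 1 (kit j314664, GRH): `L₁` of degree 24, `h(L₁) = 8` `[4, 2]`, 12 primes of `L₁` above `3` and the bad primes,
`3`-rank of `Cl(L₁)/⟨their classes⟩` = 0. Shape (C). First (A)/U₀ record for this row free of `μ`-inputs, Fukuda facts and anchors. -/

/-- `Δ(365040ig1) = ((-8436480))³` — a CUBE (kernel, `norm_num`). [cite: Serre1972, §5.3] [cite: Cremona2006, Table 1 (Cremona label 365040ig1)] -/
theorem Δ_cube_g365040ig1 : (⟨0, 0, 0, (-43217187), 109359897634⟩ : WeierstrassCurve ℚ).Δ = (((-8436480) : ℚ)) ^ 3 := by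
  norm_num [WeierstrassCurve.Δ, WeierstrassCurve.b₂, WeierstrassCurve.b₄, WeierstrassCurve.b₆, WeierstrassCurve.b₈]

/-- **(A) AT `(365040ig1, 3)` — NO NAMED FACT.**  Statement (A) of Coates–Sujatha for THIS curve at `p = 3` (the dual fine Selmer group over `ℚ_cyc` is
finitely generated over `ℤ₃`, every cyclotomic `ℤ₃`-extension), by door L5 at layer 1, shape (C): KERNEL `irr_g365040ig1_3`, `Δ_cube_g365040ig1`;
DISPLAYED `hh1` (`3 ∤ h(L₁) = 8`, GRH, kit j314664). Per row; nothing booked; (A)/BSD proved for no class.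
[cite: CoatesSujatha2005, §3 Thm. 3.4 and Lemma 3.8] [cite: DeoRaySujatha2023, §3 Thm. 3.8 (c1), (c2), (c3) (arXiv:2202.09937 p. 9)]
[cite: Serre1972, §2.4 Prop. 15, §5.3] [cite: Cremona2006, Table 1 (Cremona label 365040ig1)] -/
theorem conjA_g365040ig1_3_L5
    {W : WeierstrassCurve ℚ} [W.IsElliptic] (hWeq : W = (⟨0, 0, 0, (-43217187), 109359897634⟩ : WeierstrassCurve ℚ))
    (hh1 : ∀ κ : ZpExtension ℚ 3, κ.IsCyclotomic →
      haveI := κ.isGalois_layer_holds (0 + 1)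
      haveI := κ.finiteDimensional_layer_holds (0 + 1)
      haveI : NumberField ↥(W.divisionField 3 ⊔ κ.layer (0 + 1)) := NumberField.of_module_finite ℚ _
      ¬ 3 ∣ NumberField.classNumber ↥(W.divisionField 3 ⊔ κ.layer (0 + 1)))
    (κ : ZpExtension ℚ 3) (hκ : κ.IsCyclotomic) :
    ∃ (γ : absoluteGaloisGroup ℚ) (Df : W.FineSelmerDualData κ γ),
      Module.Finite ℤ_[3] (RestrictScalars ℤ_[3] (IwasawaAlgebra 3) Df.X) := by
  subst hWeq
  exact WildFineSelmerLayerOneL5Door.conjA_three_layer_one_of_Δ_eq_cube_of_not_dvd_classNumber _ irr_g365040ig1_3 Δ_cube_g365040ig1 hh1 κ hκ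

/-- **RECORD — U₀ `ord₃ #Ш(E) ≤ ord₃ #Ш(E)_an` for `E = 365040ig1` at `p = 3` on the fact-free door L5 (layer 1, shape (C))** (U₀-ns row of K9 items
19189 / 19197): KERNEL `classO6_g365040ig1_3`, `irr_g365040ig1_3`, `Δ_cube_g365040ig1`; DISPLAYED named facts `hKatoA hGZK hmod` ONLY, Cremona's `r_an = 0` (`hr`), and
`hh1` (`3 ∤ h(L₁) = 8`, GRH, kit j314664). Per row; nothing booked; BSD is not proved by this.
[cite: Kato2004Asterisque, Thm. 14.5 (3) (p. 236) and Prop. 14.16 (2)] [cite: CoatesSujatha2005, §3 Thm. 3.4]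
[cite: DeoRaySujatha2023, §3 Thm. 3.8] [cite: Cremona2006, Table 1 (Cremona label 365040ig1)] -/
theorem missingUpperBoundAt_g365040ig1_3_L5
    (hKatoA : Kato2004.rankZero_padicValNat_sha_add_padicValNat_tamagawa_le_of_additive_potGood_of_irreducible_of_fineSelmerDual_fg)
    (hGZK : rank_eq_analyticRank_of_analyticRank_le_one) (hmod : hasEntireLFunction_rat)
    {W : WeierstrassCurve ℚ} [W.IsElliptic] [W.IsGloballyMinimal] (hWeq : W = (⟨0, 0, 0, (-43217187), 109359897634⟩ : WeierstrassCurve ℚ)) (hr : W.analyticRank = 0)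
    (hh1 : ∀ κ : ZpExtension ℚ 3, κ.IsCyclotomic →
      haveI := κ.isGalois_layer_holds (0 + 1)
      haveI := κ.finiteDimensional_layer_holds (0 + 1)
      haveI : NumberField ↥(W.divisionField 3 ⊔ κ.layer (0 + 1)) := NumberField.of_module_finite ℚ _
      ¬ 3 ∣ NumberField.classNumber ↥(W.divisionField 3 ⊔ κ.layer (0 + 1))) :
    MissingUpperBoundAt W 3 := by
  subst hWeq
  haveI : Fact (Nat.Prime 3) := ⟨Nat.prime_three⟩
  exact WildFineSelmerSupersingularCMAnchor.missingUpperBoundAt_wild_of_conjA hKatoA hGZK hmod _ hr classO6_g365040ig1_3 irr_g365040ig1_3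
    (fun κ hκ => conjA_g365040ig1_3_L5 rfl hh1 κ hκ)

end Summit.BirchSwinnertonDyer.BirchSwinnertonDyer.Theorems.WildFineSelmerLayerOneL5Records

end
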